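import Mathlib
import Literature.NumberTheory.EllipticCurves.Smith2016.CongruentNumberGenusDeterminantOddForest
import Literature.NumberTheory.EllipticCurves.Smith2016.CongruentNumberGenusDeterminantHolds
import Literature.NumberTheory.EllipticCurves.Smith2016.CongruentNumberGenusDeterminantRowsTwoThree

/-!
# Smith 2016, Theorem 2.2 row 3, PROVED for every number of prime factors: `smith_thm22_rowThree_holds`

A. Smith, *The congruent numbers have positive natural density*, arXiv:1603.08479, Thm. 2.2 row 3
[Smith2016CongruentDensity]: for `n = p₁⋯p_k ≡ 3 (mod 8)` square-free,
`ℒ₃(n) = Σ_{d ∣ n, d ≡ 3 (8)} g(d) ℒ(n/d) = Σ_{n = d₀⋯d_ℓ, dᵢ ≡ 1 (8) (i > 0)} ∏ g(dᵢ)` equals, in `𝔽₂`, the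
determinant of (Smith's `M₃`, equivalently) Monsky's odd matrix `M`.  The named fact
`smith_thm22_rowThree` (`CongruentNumberGenusDeterminantRowsTwoThree`) is DISCHARGED here, for all `k`:
* `CongruentNumberGenusDeterminantOddForest`: `det M = Σ_j t_j · adj(N)_{(inl j),(inl j)}` (`N` the
  doubled forest matrix of `A`, `t_j = (−1/p_j)₊`) and the block dictionary
  `q_z(A^B) = ν(d_B) := [d_B ≡ 1 (4) ∨ d_B ≡ 3 (8)] · g(d_B)`;
* `Literature/LinearAlgebra/Matrix/BipartiteForestCofactor`: `adj(N)_{(inl j),(inl j)}` is the forest sum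
  pointed at the block of `j` (weight `q_z`), the other blocks weighted `(1 + z_B) q_z(A^B) = [d_B ≡ 1 (8)] g(d_B)`;
* this file: for each anchor `j` the pointed forest sum is the decomposition sum of the ANCHORED
  product weight `W_j(d) = ν(d)` if `p_j ∣ d`, `= [d ≡ 1 (8)] g(d)` otherwise (Smith's recursion
  (eq:n1rec) at the prime `p_j`, the tree's `sum_decompositions_blockProd_rec`), so that
  `det M = Σ_D Σ_j t_j ∏_{d ∈ D} W_j(d)`; regrouping the anchors `j` by the factor `d₀ ∋ p_j` of `D`
  gives `Σ_D Σ_{d₀ ∈ D} [d₀ ≡ 3 (4)] ν(d₀) ∏_{d ≠ d₀} [d ≡ 1 (8)] g(d)`, and `[d₀ ≡ 3 (4)] ν(d₀) =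
  [d₀ ≡ 3 (8)] g(d₀)`; finally for `n ≡ 3 (8)` a decomposition with at most one factor `≢ 1 (8)` has
  exactly one, `≡ 3 (8)` — which is `ℒ₃(n) = genusSum₁ n g`.
Consequences already in the tree relative to the named fact become unconditional
(`CongruentNumberGenusDeterminantRowsTwoThreeConsequences`: Tian–Yuan–Zhang's (journal) Theorem 1.2 on
`n ≡ 3 (8)` for every `k`; see `CongruentNumberGenusDeterminantRowsTwoThreeUnconditional`).
-/

namespace Literature.NumberTheory.EllipticCurves.Smith2016

open _root_.Matrix Finset Literature.LinearAlgebra.Matrix Literature.Combinatorics.Enumerative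
open Literature.NumberTheory.EllipticCurves.HeathBrown1994
open Literature.NumberTheory.EllipticCurves.TianYuanZhang2017
open Literature.NumberTheory.EllipticCurves.MonskySelmerParity

variable {k : ℕ} (p : Fin k → ℕ)

section Anchored

/-- **The blocks away from the anchor**: the forest sum of `A` with marks = roots = extra roots = `z`
over a vertex set `S` is the decomposition sum of `∏_S pᵢ` with weight `[d ≡ 1 (8)] g(d)` (row 1).
[cite: Smith2016CongruentDensity, §2 Prop. 2.4 and Table 1 (the weight g(d), d ≡ 1 (8))] [cite: TianYuanZhang2017, Thm. 1.1] -/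
theorem setExp_fwt_legendre_eq_sum_decompositions (hp : ∀ i, (p i).Prime) (hodd : ∀ i, Odd (p i))
    (hinj : Function.Injective p) (S : Finset (Fin k)) :
    setExp (fwt (fun i j => legendreMatrix p i j) (fun i => addLegendreSym 2 (p i))
        (fun i => addLegendreSym 2 (p i)) (fun i => addLegendreSym 2 (p i))) S =
      ∑ D ∈ decompositions (∏ i ∈ S, p i), ∏ d ∈ D,
        (if d % 8 = 1 then ((genusClassNumber (GenusField d) : ℕ) : ZMod 2) else 0) := by
  rw [sum_decompositions_eq_setExp p hp hinj _ S]
  refine setExp_congr fun B _ hB => ?_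
  rw [← blockWeight_eq_genusWeight p hp hodd hinj hB, fwt]
  ring

/-- **The pointed forest sum at the anchor `j` is an anchored decomposition sum**: for every `j`,
`adj(N)_{(inl j),(inl j)} = Σ_{D ∈ decompositions(∏ pᵢ)} ∏_{d ∈ D} W_j(d)` with
`W_j(d) = [d ≡ 1 (4) ∨ d ≡ 3 (8)] g(d)` if `p_j ∣ d` and `W_j(d) = [d ≡ 1 (8)] g(d)` otherwise
(Smith's (eq:n1rec) "if `p` is any prime divisor of `n`", read at `p = p_j`).
[cite: Smith2016CongruentDensity, §2 Definition of ℒ, (eq:n1rec) (chunk p0005 L34–L44) and §2.2 (chunk p0008 L42–L50)] -/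
theorem adjugate_bigN_legendre_inl_eq_sum_decompositions (hp : ∀ i, (p i).Prime)
    (hodd : ∀ i, Odd (p i)) (hinj : Function.Injective p) (j : Fin k) :
    (bigN (fun i j => legendreMatrix p i j) univ (fun i => addLegendreSym 2 (p i))
        (fun i => addLegendreSym 2 (p i)) (fun i => addLegendreSym 2 (p i))).adjugate
          (Sum.inl j) (Sum.inl j) =
      ∑ D ∈ decompositions (∏ i, p i), ∏ d ∈ D,
        (if p j ∣ d then
          (if d % 4 = 1 then ((genusClassNumber (GenusField d) : ℕ) : ZMod 2)
            else if d % 8 = 3 then ((genusClassNumber (GenusField d) : ℕ) : ZMod 2) else 0)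
        else (if d % 8 = 1 then ((genusClassNumber (GenusField d) : ℕ) : ZMod 2) else 0)) := by
  rw [adjugate_bigN_inl_inl _ (mem_univ j),
    show (∏ i, p i) = ∏ i ∈ (univ : Finset (Fin k)), p i from rfl,
    sum_decompositions_blockProd_rec p hp hinj _ (mem_univ j)]
  refine sum_congr rfl fun B₀ hB₀ => ?_
  rw [mem_powerset] at hB₀
  congr 1
  · -- the anchored block: `q_z(A^{jB₀}) = ν(d)` and `p_j ∣ d`
    rw [if_pos (dvd_prod_of_mem p (mem_insert_self j B₀)),
      qwt_legendre_eq_genusWeight p hp hodd hinj (insert_nonempty j B₀)]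
  · -- the other blocks: row-1 weights, and `p_j` divides none of them
    rw [setExp_fwt_legendre_eq_sum_decompositions p hp hodd hinj]
    refine sum_congr rfl fun D' hD' => prod_congr rfl fun d hd => ?_
    rw [if_neg ((insert_blockProd_mem_decompositions p hp hinj (mem_univ j) hB₀ hD').2.1 d hd)]

/-- **Regrouping the anchors by the factor they divide.** For a decomposition `D` of `∏ pᵢ` and any
weights, `Σ_j x_j ∏_{d ∈ D} (if p_j ∣ d then ν d else w d) = Σ_{d₀ ∈ D} (Σ_{j : p_j ∣ d₀} x_j) · ν(d₀) ·
∏_{d ∈ D ∖ d₀} w(d)`: every `p_j` divides exactly one factor of `D`.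
[cite: Smith2016CongruentDensity, §2.1 Remark 2.3 ("if d = p_{i₁}⋯p_{i_{r'}} is a divisor of the odd part of n … S = {i₁, …, i_{r'}}")] -/
theorem sum_mul_prod_anchored {R : Type*} [CommSemiring R] (hp : ∀ i, (p i).Prime)
    (hinj : Function.Injective p) (x : Fin k → R) (ν w : ℕ → R) {D : Finset ℕ}
    (hD : D ∈ decompositions (∏ i, p i)) :
    ∑ j, x j * ∏ d ∈ D, (if p j ∣ d then ν d else w d) =
      ∑ d₀ ∈ D, (∑ j ∈ univ.filter (fun j => p j ∣ d₀), x j) * (ν d₀ * ∏ d ∈ D.erase d₀, w d) := by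
  -- each anchor `j` sees exactly one factor `d₀(j)`
  have key : ∀ j, x j * ∏ d ∈ D, (if p j ∣ d then ν d else w d) =
      ∑ d₀ ∈ D, if p j ∣ d₀ then x j * (ν d₀ * ∏ d ∈ D.erase d₀, w d) else 0 := by
    intro j
    obtain ⟨d₀, hd₀, hjd₀, huniq, -⟩ :=
      decomposition_blockProd_structure p hp hinj (mem_univ j) (S := univ) hD
    rw [sum_eq_single_of_mem d₀ hd₀ (fun d hd hne => if_neg (fun h => hne (huniq d hd h))),
      if_pos hjd₀, ← mul_prod_erase D _ hd₀, if_pos hjd₀]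
    congr 2
    exact prod_congr rfl fun d hd =>
      if_neg (fun h => (ne_of_mem_erase hd) (huniq d (mem_of_mem_erase hd) h))
  rw [sum_congr rfl fun j _ => key j, sum_comm]
  refine sum_congr rfl fun d₀ _ => ?_
  rw [sum_filter, sum_mul]
  exact sum_congr rfl fun j _ => by split_ifs <;> simp

/-- `Σ_{j : p_j ∣ d} t_j = [d ≡ 3 (4)]` and so **`(Σ_{j : p_j ∣ d} t_j) · ν(d) = [d ≡ 3 (8)] · g(d)`** for
every divisor `d > 1` of `∏ pᵢ` (the pointed weight of the block of `d`).
[cite: Smith2016CongruentDensity, §2.2 (chunk p0008 L42–L50: Σ_{i∈S} yᵢ ≠ 0, Σ_{i∈S} zᵢ ≠ 0, d ≡ 3 (8))] -/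
theorem anchoredWeight_eq_genusWeight_three (hp : ∀ i, (p i).Prime) (hodd : ∀ i, Odd (p i))
    (hinj : Function.Injective p) {d : ℕ} (hd : d ∣ ∏ i, p i) (hd1 : 1 < d) :
    (∑ j ∈ univ.filter (fun j => p j ∣ d), addLegendreSym (-1) (p j)) *
        (if d % 4 = 1 then ((genusClassNumber (GenusField d) : ℕ) : ZMod 2)
          else if d % 8 = 3 then ((genusClassNumber (GenusField d) : ℕ) : ZMod 2) else 0) =
      if d % 8 = 3 then ((genusClassNumber (GenusField d) : ℕ) : ZMod 2) else 0 := by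
  set B : Finset (Fin k) := univ.filter (fun j => p j ∣ d) with hB
  have hdB : d = ∏ i ∈ B, p i := eq_blockProd_filter_of_dvd p hp hinj univ hd
  have hBne : B.Nonempty := by
    by_contra h
    rw [not_nonempty_iff_eq_empty] at h
    rw [h, prod_empty] at hdB
    omega
  rw [hdB, ← qwt_legendre_eq_genusWeight p hp hodd hinj hBne,
    pointedWeight_legendre_eq_genusWeight p hp hodd hinj hBne]

end Anchored

section GenusSide

/-- For `n ≡ 3 (mod 8)` and a decomposition `D` of `n`: the pointed product
`Σ_{d₀ ∈ D} [d₀ ≡ 3 (8)] g(d₀) · ∏_{d ≠ d₀} [d ≡ 1 (8)] g(d)` is `∏_D g(d)` if `D` has at most one factor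
`≢ 1 (mod 8)` (then exactly one, `≡ 3 (8)`), and `0` otherwise.
[cite: Smith2016CongruentDensity, §2 Table 2 row 3 (ℒ₃(n) = Σ_{d | n, d ≡ 3 (8)} g(d) ℒ(n/d))] [cite: TianYuanZhang2017, Thm. 1.1 (the sum Σ₁ for n ≡ 3 (8))] -/
theorem sum_pointed_prod_eq_ite {n : ℕ} (hn : n % 8 = 3) {D : Finset ℕ} (hD : D ∈ decompositions n)
    (g : ℕ → ℕ) :
    ∑ d₀ ∈ D, (if d₀ % 8 = 3 then ((g d₀ : ℕ) : ZMod 2) else 0) *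
        ∏ d ∈ D.erase d₀, (if d % 8 = 1 then ((g d : ℕ) : ZMod 2) else 0) =
      if (D.filter fun d => d % 8 ≠ 1).card ≤ 1 then ((∏ d ∈ D, g d : ℕ) : ZMod 2) else 0 := by
  obtain ⟨-, -, -, hprod⟩ := mem_decompositions_iff.mp hD
  by_cases hc : (D.filter fun d => d % 8 ≠ 1).card ≤ 1
  · rw [if_pos hc]
    -- there is a factor `d* ≢ 1 (8)` (else `n ≡ 1`), it is unique, the others are `≡ 1`, and `d* ≡ 3`
    have hex : ∃ d ∈ D, d % 8 ≠ 1 := by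
      by_contra h
      push Not at h
      have : n % 8 = 1 := by
        rw [← hprod, Finset.prod_nat_mod, prod_congr rfl fun d hd => h d hd, prod_const_one]
        rfl
      omega
    obtain ⟨dstar, hds, hds8⟩ := hex
    have hF : {dstar} = D.filter (fun d => d % 8 ≠ 1) :=
      eq_of_subset_of_card_le (singleton_subset_iff.mpr (mem_filter.mpr ⟨hds, hds8⟩))
        (by rw [card_singleton]; exact hc)
    have hothers : ∀ d ∈ D.erase dstar, d % 8 = 1 := by
      intro d hd
      by_contra h8
      have : d ∈ D.filter (fun d => d % 8 ≠ 1) := mem_filter.mpr ⟨mem_of_mem_erase hd, h8⟩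
      rw [← hF, mem_singleton] at this
      exact ne_of_mem_erase hd this
    have hrest : (∏ d ∈ D.erase dstar, d) % 8 = 1 := by
      rw [Finset.prod_nat_mod, prod_congr rfl fun d hd => hothers d hd, prod_const_one]
      rfl
    have hds3 : dstar % 8 = 3 := by
      have h := mul_prod_erase D (fun d => d) hds
      rw [hprod] at h
      have : n % 8 = dstar % 8 := by rw [← h, Nat.mul_mod, hrest, mul_one, Nat.mod_mod]
      omega
    rw [sum_eq_single_of_mem dstar hds (fun d hd hne => by
      rw [if_neg (by have := hothers d (mem_erase.mpr ⟨hne, hd⟩); omega), zero_mul]),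
      if_pos hds3, prod_congr rfl fun d hd => if_pos (hothers d hd), ← Nat.cast_prod, ← Nat.cast_mul,
      mul_prod_erase D g hds]
  · rw [if_neg hc]
    refine sum_eq_zero fun d₀ hd₀ => ?_
    by_cases h3 : d₀ % 8 = 3
    · -- a second factor `≢ 1 (8)` kills the product
      rw [if_pos h3]
      have hlt : 1 < (D.filter fun d => d % 8 ≠ 1).card := by omega
      obtain ⟨d', hd', hne⟩ := exists_mem_ne hlt d₀
      rw [mem_filter] at hd'
      rw [prod_eq_zero (mem_erase.mpr ⟨hne, hd'.1⟩) (if_neg hd'.2), mul_zero]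
    · rw [if_neg h3, zero_mul]

/-- For `n ≡ 3 (mod 8)`, the genus sum `ℒ₃(n) = genusSum₁ n g` in `𝔽₂` is the pointed decomposition sum
`Σ_D Σ_{d₀ ∈ D} [d₀ ≡ 3 (8)] g(d₀) ∏_{d ≠ d₀} [d ≡ 1 (8)] g(d)`.
[cite: Smith2016CongruentDensity, §2 Table 2 row 3 (ℒ₃) with Thm. 2.1 (ℒ_x(n) is TYZ's genus sum)] [cite: TianYuanZhang2017, Thm. 1.1] -/
theorem natCast_genusSum₁_eq_sum_pointed {n : ℕ} (hn : n % 8 = 3) (g : ℕ → ℕ) :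
    ((genusSum₁ n g : ℕ) : ZMod 2) =
      ∑ D ∈ decompositions n, ∑ d₀ ∈ D, (if d₀ % 8 = 3 then ((g d₀ : ℕ) : ZMod 2) else 0) *
        ∏ d ∈ D.erase d₀, (if d % 8 = 1 then ((g d : ℕ) : ZMod 2) else 0) := by
  unfold genusSum₁
  rw [Nat.cast_sum, sum_filter]
  refine sum_congr rfl fun D hD => ?_
  rw [sum_pointed_prod_eq_ite hn hD g]

end GenusSide

section RowThree

/-- **Smith 2016, Theorem 2.2, row 3 — PROVED for every `k`**: for `n = p₁⋯p_k ≡ 3 (mod 8)` a product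
of distinct odd primes, `ℒ₃(n) = Σ_{n = d₀⋯d_ℓ, dᵢ ≡ 1 (8) (i>0)} ∏ᵢ g(dᵢ) ≡ det M (mod 2)`, `M` Monsky's odd
matrix: the named fact `smith_thm22_rowThree` discharged.  Proof: `det M = Σ_j t_j adj(N)_{jj}`
(bordered determinant), each cofactor an anchored decomposition sum (pointed forest formula + Rédei
dictionary), regrouping of the anchors, and the shape of `ℒ₃` for `n ≡ 3 (8)`.
[cite: Smith2016CongruentDensity, Thm. 2.2 row 3 (arXiv:1603.08479 §2, chunk p0005 L59–L63) and §2.2 (chunk p0008 L30–L50)] -/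
theorem smith_thm22_rowThree_holds : smith_thm22_rowThree := by
  intro k p hp hodd hinj h8
  have h4 : (∏ i, p i) % 4 = 3 := by omega
  rw [det_monskyMatrixOdd_eq_sum_mul_adjugate p hp hodd hinj h4, natCast_genusSum₁_eq_sum_pointed h8]
  have hj : ∀ j, addLegendreSym (-1) (p j) *
      (bigN (fun i j => legendreMatrix p i j) univ (fun i => addLegendreSym 2 (p i))
        (fun i => addLegendreSym 2 (p i)) (fun i => addLegendreSym 2 (p i))).adjugate
          (Sum.inl j) (Sum.inl j) =
      ∑ D ∈ decompositions (∏ i, p i), addLegendreSym (-1) (p j) * ∏ d ∈ D,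
        (if p j ∣ d then
          (if d % 4 = 1 then ((genusClassNumber (GenusField d) : ℕ) : ZMod 2)
            else if d % 8 = 3 then ((genusClassNumber (GenusField d) : ℕ) : ZMod 2) else 0)
        else (if d % 8 = 1 then ((genusClassNumber (GenusField d) : ℕ) : ZMod 2) else 0)) := by
    intro j
    rw [adjugate_bigN_legendre_inl_eq_sum_decompositions p hp hodd hinj j, mul_sum]
  rw [Fintype.sum_congr _ _ hj, sum_comm]
  refine sum_congr rfl fun D hD => ?_
  rw [sum_mul_prod_anchored p hp hinj _ _ _ hD]
  refine sum_congr rfl fun d₀ hd₀ => ?_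
  obtain ⟨hsub, hgt, -, -⟩ := mem_decompositions_iff.mp hD
  have hdvd : d₀ ∣ ∏ i, p i := (Nat.mem_divisors.mp (hsub hd₀)).1
  rw [← mul_assoc, anchoredWeight_eq_genusWeight_three p hp hodd hinj hdvd (hgt d₀ hd₀)]

end RowThree

end Literature.NumberTheory.EllipticCurves.Smith2016
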